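import Summits.PneNP.PneNP.Theorems.SymmetryBudgetNoHiddenOrderLogBranchSum
import Summits.PneNP.PneNP.Theorems.SymmetryBudgetNoHiddenOrderBranchSumTransition

/-!
# log-BranchSum for transition data

The logarithmic branch-sum bound `Σ_{k<N} ⌊log₂ d_k⌋ ≤ 4·|V| + ⌊log₂|V|⌋`
(`BranchSum.RefinementPath.sum_log_d_le`, ANALYSIS-4 §8 Theorem G) restated for seat 2's
`BranchSum.TransitionData` — the form in which the Corneil–Goldberg process delivers its root–leaf
paths (`SymmetryBudgetNoHiddenOrderBranchSumTransition.lean`, via `toRefinementPath`).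
Supports stmt-PneNP-14781.
-/

-- `Summit.PneNP.PneNP.…` duplicates `PneNP` BY DESIGN (single-problem summit, D-0017 layout).
set_option linter.dupNamespace false

namespace Summit.PneNP.PneNP.Theorems

open Finset

namespace BranchSum

variable {V : Type*} [DecidableEq V] {G : SimpleGraph V} [DecidableRel G.Adj] {N : ℕ}

/-- **log-BranchSum for transition data**: along the transition data of an
individualisation–refinement–section process, `Σ_{k<N} ⌊log₂ d_k⌋ ≤ 4·|V| + ⌊log₂ |V|⌋`. -/
theorem TransitionData.sum_log_d_le [Fintype V] (T : TransitionData G N) :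
    ∑ k ∈ range N, Nat.log 2 (T.d k) ≤ 4 * Fintype.card V + Nat.log 2 (Fintype.card V) :=
  T.toRefinementPath.sum_log_d_le

end BranchSum

end Summit.PneNP.PneNP.Theorems
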